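import Summits.Ventures.DiscreteObjects.Hadamard.ConferenceGraph333Normalizer83

/-!
# The normaliser of an element of order `83` in an automorphism group of srg(333,166,82,83) has order dividing `332` (kernel)

Framing: lottery ticket; floor = certified bounds/negative ranges.  Cell pub-namedobj (venture DiscreteObjects),
target (H) = `H(668)`, hadamard gen 32.  Completes `ConferenceGraph333Normalizer83` (`|N| = 83 · 2^a`) with the bound `2^a ≤ 4` on the `2`-part:
* `normalizing_mul_pow` — `g ρ = ρ^m g ⇒ g ρ^j = ρ^(m j) g`;
* `normalizing_two_power_dichotomy` — a `2`-element `g` (`g^(2^k) = 1`) normalising `ρ` of order `83` CENTRALISES or INVERTS it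
  (`m^(2^k) ≡ 1`, `m^82 ≡ 1 (mod 83)` ⇒ `m² ≡ 1` ⇒ `m ≡ ±1`);
* **`normalizer83_card_dvd_332`** — for a group `N` of automorphisms normalising `⟨ρ⟩` (`ρ ∈ N` of order `83`): `|N| ∣ 332 = 4·83`.
  Proof: a subgroup `P ≤ N` of order `8` (Sylow) carries the sign homomorphism `ψ : P → ℤˣ` (centralise ↦ 1, invert ↦ −1); `ker ψ` embeds in the
  centralising subgroup `N ∩ C(ρ)` of order `83` or `166` (`centralizer83_card`), so `|ker ψ| ≤ 2`, and `[P : ker ψ] ≤ |ℤˣ| = 2`: `8 ≤ 4`, absurd.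
So a Sylow `83`-normaliser of Aut(srg(333,166,82,83)) has order `83`, `166` or `332` (the last would contain an element inverting `ρ`).
WORDS: structure of a HYPOTHETICAL object; ours (PROVISIONAL; standard group theory).  No `sorry`, no new definitions.
-/

namespace Summit.Ventures.DiscreteObjects.Hadamard

open Finset

section normalizer83index
variable {V : Type*} [Fintype V] [DecidableEq V]

omit [Fintype V] [DecidableEq V] in
/-- `g ρ = ρ^m g` implies `g ρ^j = ρ^(m j) g`. -/
theorem normalizing_mul_pow (g ρ : Equiv.Perm V) {m : ℕ} (h : g * ρ = ρ ^ m * g) (j : ℕ) :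
    g * ρ ^ j = ρ ^ (m * j) * g := by
  induction j with
  | zero => simp
  | succ j ih => rw [pow_succ, ← mul_assoc, ih, mul_assoc, h, ← mul_assoc, ← pow_add, Nat.mul_succ]

omit [Fintype V] [DecidableEq V] in
/-- **A `2`-element normalising an element `ρ` of order `83` centralises or inverts it.** -/
theorem normalizing_two_power_dichotomy (g ρ : Equiv.Perm V) (hρo : orderOf ρ = 83) {m k : ℕ}
    (h : g * ρ = ρ ^ m * g) (hgk : g ^ (2 ^ k) = 1) : g * ρ = ρ * g ∨ g * ρ = ρ ^ 82 * g := by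
  have hk := normalizing_pow_pow g ρ h (2 ^ k)
  rw [hgk, one_mul, mul_one] at hk
  have hmod : m ^ (2 ^ k) ≡ 1 [MOD 83] := by
    have e : ρ ^ (m ^ (2 ^ k)) = ρ ^ 1 := by rw [pow_one]; exact hk.symm
    rw [pow_eq_pow_iff_modEq, hρo] at e
    exact e
  have hm0 : (m : ZMod 83) ≠ 0 := by
    intro h0
    rw [ZMod.natCast_eq_zero_iff] at h0
    obtain ⟨c, rfl⟩ := h0
    have : ρ ^ (83 * c) = 1 := by rw [pow_mul, ← hρo, pow_orderOf_eq_one, one_pow]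
    rw [this, one_mul] at h
    have hρ1 : ρ = 1 := mul_left_cancel (h.trans (mul_one g).symm)
    rw [hρ1, orderOf_one] at hρo
    exact absurd hρo (by norm_num)
  haveI : Fact (Nat.Prime 83) := ⟨by norm_num⟩
  have h1 : (m : ZMod 83) ^ (2 ^ k) = 1 := by
    have := (ZMod.natCast_eq_natCast_iff _ _ _).mpr hmod
    rwa [Nat.cast_pow, Nat.cast_one] at this
  have h2 : (m : ZMod 83) ^ 82 = 1 := ZMod.pow_card_sub_one_eq_one hm0
  have hg2 : (m : ZMod 83) ^ Nat.gcd (2 ^ k) 82 = 1 := pow_gcd_eq_one.mpr ⟨h1, h2⟩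
  have hdvd : Nat.gcd (2 ^ k) 82 ∣ 2 := by
    have h82 : Nat.gcd (2 ^ k) 82 ∣ 82 := Nat.gcd_dvd_right _ _
    have h2k : Nat.gcd (2 ^ k) 82 ∣ 2 ^ k := Nat.gcd_dvd_left _ _
    obtain ⟨i, -, hieq⟩ := (Nat.dvd_prime_pow Nat.prime_two).mp h2k
    rw [hieq] at h82 ⊢
    rcases i with _ | _ | i
    · simp
    · simp
    · exfalso
      have : 4 ∣ 82 := dvd_trans ⟨2 ^ i, by ring⟩ h82
      omega
  have hsq : (m : ZMod 83) * (m : ZMod 83) = 1 := by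
    obtain ⟨t, ht⟩ := hdvd
    rw [← pow_two, ht, pow_mul, hg2, one_pow]
  rcases mul_self_eq_one_iff.mp hsq with hm1 | hm1
  · left
    have hmod1 : m ≡ 1 [MOD 83] := by rw [← ZMod.natCast_eq_natCast_iff, Nat.cast_one]; exact hm1
    have e : ρ ^ m = ρ ^ 1 := by rw [pow_eq_pow_iff_modEq, hρo]; exact hmod1
    rw [h, e, pow_one]
  · right
    have hmod82 : m ≡ 82 [MOD 83] := by
      rw [← ZMod.natCast_eq_natCast_iff, hm1]; decide
    have e : ρ ^ m = ρ ^ 82 := by rw [pow_eq_pow_iff_modEq, hρo]; exact hmod82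
    rw [h, e]

/-- **`|N(⟨ρ₈₃⟩)| ∣ 332`.**  `N` a group of automorphisms of an `srg(333,166,82,83)` all of whose elements normalise `⟨ρ⟩`, `ρ ∈ N` of order `83`. -/
theorem normalizer83_card_dvd_332 (hV : Fintype.card V = 333) (A : Matrix V V ℤ)
    (h01 : ∀ x y, A x y = 0 ∨ A x y = 1) (hsymm : ∀ x y, A y x = A x y) (hdiag : ∀ x, A x x = 0)
    (hk : ∀ x, ∑ y, A x y = 166) (hsrg : ∀ x y, ∑ z, A x z * A z y = 83 * (1 + (if x = y then 1 else 0)) - A x y)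
    (N : Subgroup (Equiv.Perm V)) (hN : ∀ g ∈ N, ∀ x y, A (g x) (g y) = A x y)
    (ρ : Equiv.Perm V) (hρ : ρ ^ 83 = 1) (hρ1 : ρ ≠ 1) (hρN : ρ ∈ N) (hnorm : ∀ g ∈ N, ∃ m : ℕ, g * ρ = ρ ^ m * g) :
    Nat.card N ∣ 332 := by
  classical
  haveI : Fact (Nat.Prime 83) := ⟨by norm_num⟩
  haveI : Fact (Nat.Prime 2) := ⟨Nat.prime_two⟩
  have hρo : orderOf ρ = 83 := orderOf_eq_prime hρ hρ1
  obtain ⟨a, ha⟩ := normalizer83_card_shape hV A h01 hsymm hdiag hk hsrg N hN ρ hρ hρ1 hρN hnorm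
  suffices h8 : ¬ 8 ∣ Nat.card N by
    rw [ha] at h8 ⊢
    rcases a with _ | _ | _ | a
    · norm_num
    · norm_num
    · norm_num
    · exfalso; apply h8; exact ⟨83 * 2 ^ a, by ring⟩
  intro h8
  obtain ⟨P, hP⟩ := Sylow.exists_subgroup_card_pow_prime (G := N) 2 (n := 3)
    (by rw [show (2 : ℕ) ^ 3 = 8 by norm_num]; exact h8)
  -- the centralising subgroup N ⊓ C(ρ) has order 83 or 166
  set C' : Subgroup (Equiv.Perm V) := N ⊓ Subgroup.centralizer {ρ} with hC'
  have hC'mem : ∀ g : Equiv.Perm V, g ∈ C' ↔ g ∈ N ∧ g * ρ = ρ * g := by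
    intro g
    rw [hC', Subgroup.mem_inf, Subgroup.mem_centralizer_iff]
    simp only [Set.mem_singleton_iff, forall_eq]
    exact ⟨fun ⟨h1, h2⟩ => ⟨h1, h2.symm⟩, fun ⟨h1, h2⟩ => ⟨h1, h2.symm⟩⟩
  have hcard' : Nat.card C' = 83 ∨ Nat.card C' = 166 :=
    centralizer83_card hV A h01 hsymm hdiag hk hsrg C' (fun g hg => hN g ((hC'mem g).mp hg).1) ρ hρ hρ1
      ((hC'mem ρ).mpr ⟨hρN, rfl⟩) (fun g hg => ((hC'mem g).mp hg).2)
  -- every element of P centralises or inverts ρ, never both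
  have hel : ∀ g : P, ((g : N) : Equiv.Perm V) * ρ = ρ * ((g : N) : Equiv.Perm V) ∨
      ((g : N) : Equiv.Perm V) * ρ = ρ ^ 82 * ((g : N) : Equiv.Perm V) := by
    intro g
    obtain ⟨m, hm⟩ := hnorm _ (g : N).2
    have hg8 : ((g : N) : Equiv.Perm V) ^ (2 ^ 3) = 1 := by
      have hd : orderOf g ∣ 2 ^ 3 := by rw [← hP]; exact orderOf_dvd_natCard g
      have : orderOf ((g : N) : Equiv.Perm V) ∣ 2 ^ 3 := by rwa [Subgroup.orderOf_coe, Subgroup.orderOf_coe]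
      exact orderOf_dvd_iff_pow_eq_one.mp this
    exact normalizing_two_power_dichotomy _ ρ hρo hm hg8
  have hnotboth : ∀ g : Equiv.Perm V, g * ρ = ρ * g → g * ρ = ρ ^ 82 * g → False := by
    intro g h1 h2
    rw [h1] at h2
    have : ρ = ρ ^ 82 := mul_right_cancel h2
    have e : ρ ^ 1 = ρ ^ 82 := by rw [pow_one]; exact this
    rw [pow_eq_pow_iff_modEq, hρo] at e
    exact absurd e (by decide)
  have hinv_comm : ∀ g : Equiv.Perm V, g * ρ = ρ ^ 82 * g → g * ρ ^ 82 = ρ * g := by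
    intro g h
    have := normalizing_mul_pow g ρ h 82
    rw [this]
    have e : ρ ^ (82 * 82) = ρ ^ 1 := by
      rw [pow_eq_pow_iff_modEq, hρo]; decide
    rw [e, pow_one]
  -- the sign homomorphism
  let ψ : P →* ℤˣ :=
    { toFun := fun g => if ((g : N) : Equiv.Perm V) * ρ = ρ * ((g : N) : Equiv.Perm V) then 1 else -1
      map_one' := by simp
      map_mul' := fun a b => by
        have hab : (((a * b : P) : N) : Equiv.Perm V) = ((a : N) : Equiv.Perm V) * ((b : N) : Equiv.Perm V) := by simp
        simp only [hab]
        rcases hel a with ha | ha <;> rcases hel b with hb | hb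
        · have hc : ((a : N) : Equiv.Perm V) * ((b : N) : Equiv.Perm V) * ρ = ρ * (((a : N) : Equiv.Perm V) * ((b : N) : Equiv.Perm V)) := by
            rw [mul_assoc, hb, ← mul_assoc, ha, mul_assoc]
          rw [if_pos hc, if_pos ha, if_pos hb, one_mul]
        · have hc : ((a : N) : Equiv.Perm V) * ((b : N) : Equiv.Perm V) * ρ = ρ ^ 82 * (((a : N) : Equiv.Perm V) * ((b : N) : Equiv.Perm V)) := by
            rw [mul_assoc, hb, ← mul_assoc, normalizing_mul_pow _ ρ (show ((a : N) : Equiv.Perm V) * ρ = ρ ^ 1 * ((a : N) : Equiv.Perm V) by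
              rw [pow_one]; exact ha) 82, one_mul, mul_assoc]
          rw [if_neg (fun h' => hnotboth _ h' hc), if_pos ha, if_neg (fun h' => hnotboth _ h' hb), one_mul]
        · have hc : ((a : N) : Equiv.Perm V) * ((b : N) : Equiv.Perm V) * ρ = ρ ^ 82 * (((a : N) : Equiv.Perm V) * ((b : N) : Equiv.Perm V)) := by
            rw [mul_assoc, hb, ← mul_assoc, ha, mul_assoc]
          rw [if_neg (fun h' => hnotboth _ h' hc), if_neg (fun h' => hnotboth _ h' ha), if_pos hb, mul_one]
        · have hc : ((a : N) : Equiv.Perm V) * ((b : N) : Equiv.Perm V) * ρ = ρ * (((a : N) : Equiv.Perm V) * ((b : N) : Equiv.Perm V)) := by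
            rw [mul_assoc, hb, ← mul_assoc, hinv_comm _ ha, mul_assoc]
          rw [if_pos hc, if_neg (fun h' => hnotboth _ h' ha), if_neg (fun h' => hnotboth _ h' hb)]
          decide }
  have hψ : ∀ g : P, ψ g = if ((g : N) : Equiv.Perm V) * ρ = ρ * ((g : N) : Equiv.Perm V) then 1 else -1 := fun g => rfl
  have hker : ∀ g : P, g ∈ ψ.ker ↔ ((g : N) : Equiv.Perm V) * ρ = ρ * ((g : N) : Equiv.Perm V) := by
    intro g
    rw [MonoidHom.mem_ker, hψ]
    by_cases h : ((g : N) : Equiv.Perm V) * ρ = ρ * ((g : N) : Equiv.Perm V)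
    · simp [h]
    · rw [if_neg h]; simp only [h, iff_false]; decide
  -- index of ker ψ is at most 2
  have hidx : ψ.ker.index ≤ 2 := by
    rw [Subgroup.index_ker]
    calc Nat.card ψ.range ≤ Nat.card ℤˣ := Subgroup.card_le_card_group _
      _ = 2 := by rw [Nat.card_eq_fintype_card, Fintype.card_units_int]
  have hPcard : Nat.card ψ.ker * ψ.ker.index = 8 := by rw [Subgroup.card_mul_index, hP]; norm_num
  have hker_dvd8 : Nat.card ψ.ker ∣ 2 ^ 3 := by rw [← hP]; exact Subgroup.card_subgroup_dvd_card _
  -- ker ψ embeds in C'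
  let φ : P →* Equiv.Perm V := N.subtype.comp P.subtype
  have hφ : ∀ g : P, φ g = ((g : N) : Equiv.Perm V) := fun g => rfl
  have hφinj : Function.Injective φ := by
    intro a b h
    rw [hφ, hφ] at h
    exact Subtype.ext (Subtype.ext h)
  have hmap_le : (ψ.ker).map φ ≤ C' := by
    intro x hx
    obtain ⟨g, hg, rfl⟩ := Subgroup.mem_map.mp hx
    rw [hC'mem, hφ]
    exact ⟨(g : N).2, (hker g).mp hg⟩
  have hker_dvdC : Nat.card ψ.ker ∣ Nat.card C' := by
    have := Subgroup.card_dvd_of_le hmap_le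
    rwa [Subgroup.card_map_of_injective hφinj] at this
  have hker2 : Nat.card ψ.ker ∣ 2 := by
    rcases hcard' with h | h <;> rw [h] at hker_dvdC
    · exact dvd_trans (Nat.dvd_gcd hker_dvd8 hker_dvdC) (by norm_num)
    · exact dvd_trans (Nat.dvd_gcd hker_dvd8 hker_dvdC) (by norm_num)
  have hkerle : Nat.card ψ.ker ≤ 2 := Nat.le_of_dvd (by norm_num) hker2
  have := Nat.mul_le_mul hkerle hidx
  omega

end normalizer83index

end Summit.Ventures.DiscreteObjects.Hadamard
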